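import Summits.RiemannHypothesis.RiemannHypothesis.Theorems.NymanBeurlingNbThesisZeroFloor
import Summits.RiemannHypothesis.RiemannHypothesis.Theorems.NymanBeurlingNbThesisIntegrable
import HarnessLib

/-!
# Splittings — Nyman–Beurling three-lines test function: holomorphy, the value at a zero, line estimates
# (SPLIT-nb-neg gen 2, part 1/3)

The test function of the «label lemma» of card `run/shared/lean/pub/rh-split/cards/SPLIT-nb-neg.md` §2 S8 is
`G_a(s) = (s - 1 - ζ₁(s)A_a(s)) / (s²(s+1)²)` (`= (1-ζ(s)A_a(s))(s-1)/(s²(s+1)²)` off `s = 1`), for a Dirichlet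
polynomial `A_a(s) = Σ_{n<N} a_n (n+1)^{-s}`.  No definition is introduced: every lemma takes `G` with its
defining hypothesis `hG`.  Proved here (no `sorry`, standard axioms):

* `differentiableOn_nbG` — `G` is holomorphic on `Re s > 0`; `nbG_apply_zero` — at a zero `ρ ≠ 1` of `ζ` it
  takes the FIXED value `(ρ-1)/(ρ²(ρ+1)²)`; `nbG_eq_nbAux_div` — `G = F_{s,a}(s)/(s+1)²` in terms of the tree's
  `nbAux` (`Literature…NymanBeurlingDirichlet`);
* `norm_nbG_le_of_re` — on the line `Re s = 1/2 + η` the point values are controlled by the Nyman–Beurling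
  distance: `‖G(s)‖ ≤ √I(A)/η`-type bound (the tree's contour inequality `ofReal_norm_le_lintegral_line` +
  `nb_lintegral_kernel_sq_le`, i.e. the proof of `nbIntegrand_floor_of_zero` run at a general point; the
  polynomial loss of the kernel is absorbed by the weight `(s+1)⁻²`);
* `norm_nbG_le_of_two_le_re` — on a line `Re s = u ≥ 2` the value is controlled by `sup_t ‖1 - ζA‖(u+it)`;
  `norm_nbG_le_of_half_le_re` — `G` is bounded on the closed strip (Titchmarsh (2.12.2) =
  `norm_riemannZeta₁_le_of_re_pos`).

Parts 2/3 (`NbBddNaturalLineDecay.lean`: the natural approximants invert `ζ` uniformly on `Re s = 3`) and 3/3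
(`NbBddNatural.lean`: Hadamard three lines ⇒ `rh_of_nbBdd_of_line`; target T2 `liminf_N I(V_N) < ∞ ⟹ RH`)
complete the argument.

Provenance: cell rh-split, seat rh-split-nb-neg g2, zero-definition raw form
`HOME/rh-split-nb-neg/NbBddNaturalRaw.lean` (sha16 4786d65a4b4f27e0, 720 lines; proofs verbatim), split in
three files (≤ 400 lines each: `NbBddNaturalThreeLines` test-function estimates / `NbBddNaturalLineDecay`
arithmetic input / `NbBddNatural` label lemma + target T2) and filed by rh-split-typer-1 g2 on the lead's GO
2026-08-26T19:39Z (HANDOFF-list item 1).  Referee (rh-split-ref g0) addendum 19:34Z on cards/SPLIT-nb-neg.md: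
label lemma replayed std; «(A) three-lines criterion and (B) natural line decay checked on paper;
bddNaturalCriterion = liminf I(V_N) < ∞ ⟹ RH, converse open ⇒ decoration as a conjunct, by theorem»; class
UNCHANGED (barrier-note).  Typer-1 g2 replay 20:02Z of the 720-line raw form: farm rc 0, 0 warnings, 0 sorry,
`#print axioms rh_of_frequently_bdd_natural` = [propext, Classical.choice, Quot.sound].

HONEST LABEL: «SPLITTING SEARCH over kernel-typed RH-EQUIVALENCES; a splitting A ∧ B ⟹ RH is
CONDITIONAL bookkeeping unless A and B are both proved; nothing here bears on the truth of RH.»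
-/

set_option linter.dupNamespace false

noncomputable section

open Complex MeasureTheory Set Filter Topology
open scoped Real ENNReal

namespace Summit.RiemannHypothesis.RiemannHypothesis.Theorems.Splittings.NbBddNatural

/-! # The three-lines test function and its line estimates -/

open Literature.NumberTheory.LFunctions
open Summit.RiemannHypothesis.RiemannHypothesis.Theses.NymanBeurling
open Summit.RiemannHypothesis.RiemannHypothesis.Theorems

/-! ## The three-lines test function -/

/-! The test function is `G_a(s) = (s - 1 - ζ₁(s)A_a(s)) / (s²(s+1)²)` (`= (1-ζ(s)A_a(s))(s-1)/(s²(s+1)²)`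
off `s = 1`; holomorphic on `Re s > 0`; `= F_{s,a}(s)/(s+1)²` in terms of the tree's `nbAux`).  No
definition is introduced: every lemma takes `G` with the defining hypothesis `hG`. -/

/-- The test function `G` is holomorphic on the right half-plane `Re s > 0`. -/
theorem differentiableOn_nbG {N : ℕ} (a : Fin N → ℂ) {G : ℂ → ℂ}
    (hG : ∀ s, G s = (s - 1 - riemannZeta₁ s * dirichletPoly a s) / (s ^ 2 * (s + 1) ^ 2)) :
    DifferentiableOn ℂ G {s : ℂ | 0 < s.re} := by
  rw [show G = fun s ↦ (s - 1 - riemannZeta₁ s * dirichletPoly a s) / (s ^ 2 * (s + 1) ^ 2) from funext hG]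
  have h1 : Differentiable ℂ fun s ↦ s - 1 - riemannZeta₁ s * dirichletPoly a s :=
    (differentiable_id.sub_const 1).sub
      (differentiable_riemannZeta₁.mul (differentiable_dirichletPoly a))
  refine h1.differentiableOn.div ((differentiableOn_id.pow 2).mul
    ((differentiableOn_id.add_const 1).pow 2)) ?_
  intro s hs h
  have hs' : 0 < s.re := hs
  rcases mul_eq_zero.mp h with h0 | h0
  · have : s = 0 := pow_eq_zero_iff (n := 2) (by norm_num) |>.mp h0
    rw [this] at hs'; simp at hs'
  · have h2 : s + 1 = 0 := pow_eq_zero_iff (n := 2) (by norm_num) |>.mp h0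
    have : (s + 1).re = 0 := by rw [h2]; simp
    simp at this; linarith

/-- At a zero `ρ ≠ 1` of `ζ` the test function has the FIXED value `(ρ-1)/(ρ²(ρ+1)²)`, whatever the
Dirichlet polynomial. -/
theorem nbG_apply_zero {ρ : ℂ} (hζ : riemannZeta ρ = 0) (hρ1 : ρ ≠ 1) {N : ℕ} (a : Fin N → ℂ)
    {G : ℂ → ℂ}
    (hG : ∀ s, G s = (s - 1 - riemannZeta₁ s * dirichletPoly a s) / (s ^ 2 * (s + 1) ^ 2)) :
    G ρ = (ρ - 1) / (ρ ^ 2 * (ρ + 1) ^ 2) := by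
  have hz : riemannZeta₁ ρ = 0 := by
    have h := riemannZeta_eq_inv_sub_mul hρ1
    rw [hζ] at h
    exact (mul_eq_zero.mp h.symm).resolve_left (inv_ne_zero (sub_ne_zero.mpr hρ1))
  rw [hG, hz, zero_mul, sub_zero]

/-- `G(w) = F_{w,a}(w)/(w+1)²` in terms of the tree's `nbAux`. -/
theorem nbG_eq_nbAux_div {w : ℂ} (hw : w + 1 ≠ 0) {N : ℕ} (a : Fin N → ℂ)
    {G : ℂ → ℂ}
    (hG : ∀ s, G s = (s - 1 - riemannZeta₁ s * dirichletPoly a s) / (s ^ 2 * (s + 1) ^ 2)) :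
    G w = nbAux w a w / (w + 1) ^ 2 := by
  rw [hG]
  unfold nbAux
  rw [div_self hw, mul_one, div_div]

/-! ## Line `Re s = 1/2 + η`: point values are controlled by the NB distance -/

/-- The tree's contour inequality run at a GENERAL point `w`, `Re w > 1/2` (the proof of
`nbIntegrand_floor_of_zero` without the evaluation at a zero): if `I(N,a) ≤ i` then
`2π ‖F_{w,a}(w)‖ ≤ √i · (‖w+1‖/(Re w - 1/2)) √π`. -/
theorem two_pi_mul_norm_nbAux_self_le {w : ℂ} (hw : 1 / 2 < w.re) {N : ℕ} (a : Fin N → ℂ)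
    {i : ℝ} (hi : 0 ≤ i)
    (hI : ∫⁻ t : ℝ, ENNReal.ofReal (‖1 - riemannZeta (1 / 2 + t * Complex.I) *
        ∑ n : Fin N, a n * ((n : ℂ) + 1) ^ (-(1 / 2 + t * Complex.I))‖ ^ 2 / (1 / 4 + t ^ 2)) ≤
      ENNReal.ofReal i) :
    2 * π * ‖nbAux w a w‖ ≤ Real.sqrt i * (‖w + 1‖ / (w.re - 1 / 2) * Real.sqrt π) := by
  have hδ0 : 0 < w.re - 1 / 2 := by linarith
  have hwm1 : w + 1 ≠ 0 := by
    intro h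
    have : (w + 1).re = 0 := by rw [h]; simp
    simp at this; linarith
  have hnm1 : 0 < ‖w + 1‖ := norm_pos_iff.mpr hwm1
  set v : ℝ := 2 * π * ‖nbAux w a w‖ with hv
  have hv0 : 0 ≤ v := by positivity
  set K : ℝ := (‖w + 1‖ / (w.re - 1 / 2)) ^ 2 * π with hK
  have hK0 : 0 < K := by
    have : 0 < ‖w + 1‖ / (w.re - 1 / 2) := div_pos hnm1 hδ0
    positivity
  have hsqrtK : Real.sqrt K = ‖w + 1‖ / (w.re - 1 / 2) * Real.sqrt π := by
    rw [hK, Real.sqrt_mul (sq_nonneg _), Real.sqrt_sq (div_pos hnm1 hδ0).le]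
  set Iv : ℝ≥0∞ := ∫⁻ t : ℝ, ENNReal.ofReal (‖1 - riemannZeta (1 / 2 + t * Complex.I) *
      ∑ n : Fin N, a n * ((n : ℂ) + 1) ^ (-(1 / 2 + t * Complex.I))‖ ^ 2 / (1 / 4 + t ^ 2)) with hIv
  set G : ℝ≥0∞ := ∫⁻ t : ℝ, ‖(w + 1) / ((1 / 2 : ℂ) + t * I + 1) / (1 / 2 + t * I - w)‖ₑ ^ (2 : ℝ)
    with hG
  have hGle : G ≤ ENNReal.ofReal K := nb_lintegral_kernel_sq_le hw
  have hg_meas : Measurable fun t : ℝ ↦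
      ‖(w + 1) / ((1 / 2 : ℂ) + t * I + 1) / (1 / 2 + t * I - w)‖ₑ := by
    refine Measurable.enorm ?_
    exact (by fun_prop : Measurable fun t : ℝ ↦
      (w + 1) / ((1 / 2 : ℂ) + t * I + 1) / (1 / 2 + t * I - w))
  -- Step 1: contour inequality + Cauchy–Schwarz on the critical line
  have key : ENNReal.ofReal v ≤ Iv ^ (1 / 2 : ℝ) * G ^ (1 / 2 : ℝ) := by
    set M := ∑ n : Fin N, ‖a n‖ with hM
    have hM0 : 0 ≤ M := Finset.sum_nonneg fun n _ ↦ norm_nonneg _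
    have hC : 0 ≤ (2 + 5 * M) * ‖w + 1‖ := by positivity
    have hcore := ofReal_norm_le_lintegral_line (F := nbAux w a) hw (differentiableOn_nbAux w a)
      (R₀ := 1) hC (fun s hs h1 ↦ norm_nbAux_le w a hs h1)
    refine hcore.trans ?_
    set f : ℝ → ℝ≥0∞ := fun t ↦ ENNReal.ofReal
      (‖1 - riemannZeta (1 / 2 + t * I) * dirichletPoly a (1 / 2 + t * I)‖ / ‖(1 / 2 : ℂ) + t * I‖)
      with hf
    set g : ℝ → ℝ≥0∞ := fun t ↦ ‖(w + 1) / ((1 / 2 : ℂ) + t * I + 1) / (1 / 2 + t * I - w)‖ₑ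
      with hg
    have hf_meas : Measurable f := by
      refine ENNReal.measurable_ofReal.comp ?_
      refine Measurable.div ?_ (by fun_prop)
      refine (Continuous.norm ?_).measurable
      have hc : Continuous fun t : ℝ ↦ (1 / 2 : ℂ) + t * I := by fun_prop
      exact continuous_const.sub (continuous_riemannZeta_line.mul
        ((NymanBeurlingDirichlet.continuous_dirichletPoly a).comp hc))
    calc ∫⁻ t : ℝ, ‖nbAux w a (1 / 2 + t * I) / (1 / 2 + t * I - w)‖ₑ
        = ∫⁻ t : ℝ, (f * g) t := lintegral_congr fun t ↦ enorm_nbAux_div_line w a t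
      _ ≤ (∫⁻ t, f t ^ (2 : ℝ)) ^ (1 / (2 : ℝ)) * (∫⁻ t, g t ^ (2 : ℝ)) ^ (1 / (2 : ℝ)) :=
          ENNReal.lintegral_mul_le_Lp_mul_Lq volume Real.HolderConjugate.two_two
            hf_meas.aemeasurable hg_meas.aemeasurable
      _ = Iv ^ (1 / 2 : ℝ) * G ^ (1 / 2 : ℝ) := by
          congr 2
          refine lintegral_congr fun t ↦ ?_
          rw [hf]
          dsimp only
          rw [ENNReal.rpow_two, ← ENNReal.ofReal_pow (by positivity), div_pow,
            norm_sq_one_half_add t]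
          rfl
  -- Step 2: insert the kernel bound and the distance bound, pass to reals
  have hGK : G ^ (1 / 2 : ℝ) ≤ ENNReal.ofReal (Real.sqrt K) :=
    calc G ^ (1 / 2 : ℝ) ≤ (ENNReal.ofReal K) ^ (1 / 2 : ℝ) :=
          ENNReal.rpow_le_rpow hGle (by norm_num)
      _ = ENNReal.ofReal (Real.sqrt K) := by
          rw [ENNReal.ofReal_rpow_of_nonneg hK0.le (by norm_num), Real.sqrt_eq_rpow]
  have hIi : Iv ^ (1 / 2 : ℝ) ≤ ENNReal.ofReal (Real.sqrt i) :=
    calc Iv ^ (1 / 2 : ℝ) ≤ (ENNReal.ofReal i) ^ (1 / 2 : ℝ) :=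
          ENNReal.rpow_le_rpow hI (by norm_num)
      _ = ENNReal.ofReal (Real.sqrt i) := by
          rw [ENNReal.ofReal_rpow_of_nonneg hi (by norm_num), Real.sqrt_eq_rpow]
  have key2 : ENNReal.ofReal v ≤ ENNReal.ofReal (Real.sqrt i * Real.sqrt K) := by
    calc ENNReal.ofReal v ≤ Iv ^ (1 / 2 : ℝ) * G ^ (1 / 2 : ℝ) := key
      _ ≤ ENNReal.ofReal (Real.sqrt i) * ENNReal.ofReal (Real.sqrt K) := by gcongr
      _ = ENNReal.ofReal (Real.sqrt i * Real.sqrt K) :=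
          (ENNReal.ofReal_mul (Real.sqrt_nonneg _)).symm
  have hreal : v ≤ Real.sqrt i * Real.sqrt K :=
    (ENNReal.ofReal_le_ofReal_iff (by positivity)).mp key2
  rw [hsqrtK] at hreal
  exact hreal

/-- **Line bound.** For `Re w > 1/2` and `I(N,a) ≤ i`: `‖G_a(w)‖ ≤ √i/(Re w - 1/2)` (uniform in
`Im w`: the polynomial loss of the lossy kernel is absorbed by the weight `1/(s+1)²`). -/
theorem norm_nbG_le_of_re {w : ℂ} (hw : 1 / 2 < w.re) {N : ℕ} (a : Fin N → ℂ)
    {G : ℂ → ℂ}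
    (hG : ∀ s, G s = (s - 1 - riemannZeta₁ s * dirichletPoly a s) / (s ^ 2 * (s + 1) ^ 2)) {i : ℝ} (hi : 0 ≤ i)
    (hI : ∫⁻ t : ℝ, ENNReal.ofReal (‖1 - riemannZeta (1 / 2 + t * Complex.I) *
        ∑ n : Fin N, a n * ((n : ℂ) + 1) ^ (-(1 / 2 + t * Complex.I))‖ ^ 2 / (1 / 4 + t ^ 2)) ≤
      ENNReal.ofReal i) :
    ‖G w‖ ≤ Real.sqrt i / (w.re - 1 / 2) := by
  have hδ0 : 0 < w.re - 1 / 2 := by linarith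
  have hwm1 : w + 1 ≠ 0 := by
    intro h
    have : (w + 1).re = 0 := by rw [h]; simp
    simp at this; linarith
  have hm1 : 1 ≤ ‖w + 1‖ := by
    have h1 := abs_re_le_norm (w + 1)
    have h2 : (w + 1).re = w.re + 1 := by simp
    rw [h2] at h1
    have h3 := le_abs_self (w.re + 1)
    linarith
  have h := two_pi_mul_norm_nbAux_self_le hw a hi hI
  rw [nbG_eq_nbAux_div hwm1 a hG, norm_div, norm_pow, div_le_div_iff₀ (by positivity) hδ0]
  set n : ℝ := ‖nbAux w a w‖ with hn
  set m : ℝ := ‖w + 1‖ with hm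
  set r : ℝ := Real.sqrt i with hr
  set p : ℝ := Real.sqrt π with hp
  set η : ℝ := w.re - 1 / 2 with hη
  have hn0 : 0 ≤ n := norm_nonneg _
  have hr0 : 0 ≤ r := Real.sqrt_nonneg _
  have hp0 : 0 ≤ p := Real.sqrt_nonneg _
  have hπ3 := Real.pi_gt_three
  have hp2 : p ≤ 2 * π := by
    have hp1 : p ≤ π := by
      have h1 : Real.sqrt π ≤ Real.sqrt (π ^ 2) := Real.sqrt_le_sqrt (by nlinarith)
      rw [Real.sqrt_sq Real.pi_pos.le] at h1
      rw [hp]; exact h1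
    linarith
  have h1 : 2 * π * n * η ≤ r * m * p := by
    have h' : 2 * π * n ≤ r * m * p / η := by
      calc 2 * π * n ≤ r * (m / η * p) := h
        _ = r * m * p / η := by ring
    rwa [le_div_iff₀ hδ0] at h'
  have H : n * η * (2 * π) ≤ r * m ^ 2 * (2 * π) := by
    nlinarith [mul_nonneg (mul_nonneg hr0 (by linarith : (0 : ℝ) ≤ m)) (by linarith : 0 ≤ 2 * π - p),
      mul_nonneg (mul_nonneg hr0 (by linarith : (0 : ℝ) ≤ m)) (by linarith : 0 ≤ m - 1)]
  exact le_of_mul_le_mul_right H (by positivity)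

/-! ## Line `Re s = 2` and the closed strip -/

/-- On `Re z ≥ 2`: `‖G_a(z)‖ ≤ ‖1 - ζ(z)A_a(z)‖`. -/
theorem norm_nbG_le_of_two_le_re {N : ℕ} (a : Fin N → ℂ)
    {G : ℂ → ℂ}
    (hG : ∀ s, G s = (s - 1 - riemannZeta₁ s * dirichletPoly a s) / (s ^ 2 * (s + 1) ^ 2)) {z : ℂ} (hz : 2 ≤ z.re) :
    ‖G z‖ ≤ ‖1 - riemannZeta z * dirichletPoly a z‖ := by
  have hz1 : z ≠ 1 := by intro h; rw [h] at hz; norm_num at hz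
  have hζ₁ : riemannZeta₁ z = (z - 1) * riemannZeta z := by
    rw [riemannZeta_eq_inv_sub_mul hz1]; field_simp [sub_ne_zero.mpr hz1]
  have hnum : z - 1 - riemannZeta₁ z * dirichletPoly a z =
      (z - 1) * (1 - riemannZeta z * dirichletPoly a z) := by rw [hζ₁]; ring
  have hx2 : 2 ≤ ‖z‖ := by
    have h1 := abs_re_le_norm z
    have h2 := le_abs_self z.re
    linarith
  have hx3 : 3 ≤ ‖z + 1‖ := by
    have h1 := abs_re_le_norm (z + 1)
    have h2 : (z + 1).re = z.re + 1 := by simp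
    rw [h2] at h1
    have h3 := le_abs_self (z.re + 1)
    linarith
  have hzm1 : ‖z - 1‖ ≤ ‖z‖ + 1 := by
    calc ‖z - 1‖ ≤ ‖z‖ + ‖(1 : ℂ)‖ := norm_sub_le _ _
      _ = ‖z‖ + 1 := by simp
  have hden : 0 < ‖z ^ 2 * (z + 1) ^ 2‖ := by
    rw [norm_mul, norm_pow, norm_pow]; positivity
  rw [hG]
  rw [hnum, norm_div, norm_mul, div_le_iff₀ hden, norm_mul, norm_pow, norm_pow]
  have hw0 : 0 ≤ ‖1 - riemannZeta z * dirichletPoly a z‖ := norm_nonneg _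
  have hkey : ‖z - 1‖ ≤ ‖z‖ ^ 2 * ‖z + 1‖ ^ 2 := by
    have h9 : 9 ≤ ‖z + 1‖ ^ 2 := by nlinarith
    have hzz : ‖z‖ + 1 ≤ ‖z‖ ^ 2 * 9 := by nlinarith
    have h99 : ‖z‖ ^ 2 * 9 ≤ ‖z‖ ^ 2 * ‖z + 1‖ ^ 2 :=
      mul_le_mul_of_nonneg_left h9 (sq_nonneg _)
    linarith
  calc ‖z - 1‖ * ‖1 - riemannZeta z * dirichletPoly a z‖
      ≤ (‖z‖ ^ 2 * ‖z + 1‖ ^ 2) * ‖1 - riemannZeta z * dirichletPoly a z‖ := by gcongr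
    _ = ‖1 - riemannZeta z * dirichletPoly a z‖ * (‖z‖ ^ 2 * ‖z + 1‖ ^ 2) := by ring

/-- Boundedness on `Re s ≥ 1/2` (Titchmarsh (2.12.2) via `norm_riemannZeta₁_le_of_re_pos`):
`‖G_a(s)‖ ≤ 6 + 8 Σ‖a_n‖`. -/
theorem norm_nbG_le_of_half_le_re {N : ℕ} (a : Fin N → ℂ)
    {G : ℂ → ℂ}
    (hG : ∀ s, G s = (s - 1 - riemannZeta₁ s * dirichletPoly a s) / (s ^ 2 * (s + 1) ^ 2)) {s : ℂ} (hs : 1 / 2 ≤ s.re) :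
    ‖G s‖ ≤ 6 + 8 * ∑ n : Fin N, ‖a n‖ := by
  set M := ∑ n : Fin N, ‖a n‖ with hM
  have hM0 : 0 ≤ M := Finset.sum_nonneg fun n _ ↦ norm_nonneg _
  have hs0 : 0 < s.re := by linarith
  set x : ℝ := ‖s‖ with hx
  have hx2 : 1 / 2 ≤ x := by
    have h1 := abs_re_le_norm s
    have h2 := le_abs_self s.re
    linarith
  have hx0 : 0 ≤ x := by linarith
  have hζ : ‖riemannZeta₁ s‖ ≤ x + 2 * x * (x + 1) := by
    have h := norm_riemannZeta₁_le_of_re_pos hs0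
    have hs1 : ‖s - 1‖ ≤ x + 1 := by
      calc ‖s - 1‖ ≤ ‖s‖ + ‖(1 : ℂ)‖ := norm_sub_le _ _
        _ = x + 1 := by simp [hx]
    have hdiv : x * ‖s - 1‖ / s.re ≤ x * ‖s - 1‖ / (1 / 2) :=
      div_le_div_of_nonneg_left (by positivity) (by norm_num) hs
    calc ‖riemannZeta₁ s‖ ≤ x + x * ‖s - 1‖ / s.re := h
      _ ≤ x + x * ‖s - 1‖ / (1 / 2) := by linarith
      _ = x + 2 * x * ‖s - 1‖ := by ring
      _ ≤ x + 2 * x * (x + 1) := by gcongr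
  have hA : ‖dirichletPoly a s‖ ≤ M := norm_dirichletPoly_le a hs0.le
  have hnum : ‖s - 1 - riemannZeta₁ s * dirichletPoly a s‖ ≤ (x + 1) + (x + 2 * x * (x + 1)) * M := by
    calc ‖s - 1 - riemannZeta₁ s * dirichletPoly a s‖
        ≤ ‖s - 1‖ + ‖riemannZeta₁ s * dirichletPoly a s‖ := norm_sub_le _ _
      _ ≤ (x + 1) + ‖riemannZeta₁ s‖ * ‖dirichletPoly a s‖ := by
          rw [norm_mul]; gcongr
          calc ‖s - 1‖ ≤ ‖s‖ + ‖(1 : ℂ)‖ := norm_sub_le _ _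
            _ = x + 1 := by simp [hx]
      _ ≤ (x + 1) + (x + 2 * x * (x + 1)) * M := by gcongr
  have hden : x ^ 2 * (x ^ 2 + 1) ≤ ‖s ^ 2 * (s + 1) ^ 2‖ := by
    rw [norm_mul, norm_pow, norm_pow]
    have h2 : x ^ 2 + 1 ≤ ‖s + 1‖ ^ 2 := by
      rw [hx, Complex.sq_norm, Complex.sq_norm, Complex.normSq_apply, Complex.normSq_apply]
      simp; nlinarith
    gcongr
  have hden0 : 0 < x ^ 2 * (x ^ 2 + 1) := by positivity
  have h1 : x + 1 ≤ 6 * (x ^ 2 * (x ^ 2 + 1)) := by nlinarith [sq_nonneg x, sq_nonneg (x ^ 2)]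
  have h2 : x + 2 * x * (x + 1) ≤ 8 * (x ^ 2 * (x ^ 2 + 1)) := by
    nlinarith [sq_nonneg x, sq_nonneg (x ^ 2)]
  rw [hG]
  rw [norm_div]
  calc ‖s - 1 - riemannZeta₁ s * dirichletPoly a s‖ / ‖s ^ 2 * (s + 1) ^ 2‖
      ≤ ((x + 1) + (x + 2 * x * (x + 1)) * M) / (x ^ 2 * (x ^ 2 + 1)) :=
        div_le_div₀ (by positivity) hnum hden0 hden
    _ ≤ 6 + 8 * M := by
        rw [div_le_iff₀ hden0]
        nlinarith [mul_le_mul_of_nonneg_right h2 hM0]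

end Summit.RiemannHypothesis.RiemannHypothesis.Theorems.Splittings.NbBddNatural

end
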